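import Summits.Langlands.Langlands.Theses.PhantomRMYoshida
import Summits.Langlands.Langlands.Theorems.PhantomRMYoshidaFaltingsTateModuleQGate
import Summits.Langlands.Langlands.Theorems.PhantomRMYoshidaStableYoshidaCongruenceTateModuleIrreducible

/-!
# Route PhantomRMYoshida — `StableYoshidaCongruenceModFaltings` (item stmt-Langlands-15108): reductions

The support item `StableYoshidaCongruenceModFaltings := FaltingsFinitenessI → StableYoshidaCongruence`
is the CONDITIONAL FORM of crux 3 of route `PhantomRMYoshida` (item stmt-Langlands-13640,
`StableYoshidaCongruence`: an endoscopic-to-stable congruence in Siegel weight `(2,2)`, open off the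
`p = 3` switchable sector) modulo the route's Faltings gate `FaltingsFinitenessI`
(item stmt-Langlands-15084: Finiteness I over `ℚ`, Faltings 1983 §6 + Zarhin; a theorem in print,
unformalised).  This file records, sorry-free, the reductions that make the item's bookkeeping
exact; it does not (and cannot, today) close the item, whose truth value is that of the crux.

* `stableYoshidaCongruenceModFaltings_of_stableYoshidaCongruence`: the crux implies the item
  (`fun h _ => h`) — whoever closes stmt-Langlands-13640 closes stmt-Langlands-15108 with this line.
* `tateModuleIrreducible_of_faltingsFinitenessI`: under the gate, Stub 3i of the crux's picked line
  `level-three-weierstrass-switch` (landed CONDITIONALLY on Faltings' Satz 3–4 for `(B, p)` as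
  `…LevelThreeWeierstrassSwitch.stub_tateModuleIrreducible_of`,
  `Theorems/PhantomRMYoshidaStableYoshidaCongruenceTateModuleIrreducible.lean`) becomes
  unconditional: for an abelian variety `B/ℚ` with `End_ℚ(B) = ℤ · id` and a `ℚ_p`-basis `b` of
  `V_p B` with four elements, the framed contragredient `ρ₀ ≅ H¹_ét(B_ℚ̄, ℚ̄_p)` is irreducible.
  The two Faltings inputs come from the gate through the sibling file
  `Theorems/PhantomRMYoshidaFaltingsTateModuleQGate.lean` (`faltings_tate_bijective_of_finitenessI`,
  `isSemisimpleRepresentation_rationalTateRep_of_finitenessI`, `faltingsTateModuleQ_of_finitenessI`: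
  Faltings 1983 §5 over `ℚ` from Finiteness I alone, via
  `Literature/AlgebraicGeometry/Motives/FaltingsAbelianOfFinitenessIProofs.lean`).
* `stableYoshidaCongruenceModFaltings_of_imp_faltings_facts` /
  `stableYoshidaCongruenceModFaltings_of_imp_faltingsTateModuleQ` /
  `stableYoshidaCongruenceModFaltings_of_imp_tateModuleIrreducible`: the "direct closer" shapes — a
  proof of the crux taking the line's two Faltings fact stubs (resp. the gate `FaltingsTateModuleQ`,
  item stmt-Langlands-15085; resp. the conclusion of Stub 3i) as hypotheses yields the item
  (`intro hFin` and feed the discharges).  "Finiteness I only removes the in-sector irreducibility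
  input."

What is NOT here: any claim on the crux itself.  Off the `p = 3` switchable sector the crux is the
open problem (line card `Cruxes/StableYoshidaCongruence/Lines/level-three-weierstrass-switch.md`,
`stub_offSectorRemainder`; Disproof.lean §6: expected dimension `-1`), and in Lean both `S` and `¬S`
sit behind the automorphic wall (Disproof.lean §2: no cuspidal automorphic representation of any
`GL_n(𝔸_ℚ)`, `n ≥ 2`, has been constructed in the tree).  Finiteness I removes exactly the two
Faltings inputs of the in-sector argument and nothing else.

References: [Faltings1983Endlichkeit] §5 Satz 3–4, Korollar 1; §6 Satz 5–6.  [MilneAV2008] Ch. IV,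
Thm. 1.1, §2.
-/

set_option linter.dupNamespace false -- project-wide option; `Summit.Langlands.Langlands` is the mandated namespace

namespace Summit.Langlands.Langlands.Theses.PhantomRMYoshida

open scoped BigOperators Topology Manifold Classical MeasureTheory ProbabilityTheory Matrix InnerProductSpace ComplexConjugate ContinuousMap in
open Filter Set Function TopologicalSpace MeasureTheory in
/-- **Record of the dropped route item `StableYoshidaCongruenceModFaltings`** = stmt-Langlands-15108 (ledger signature verbatim;
NOT a route item): route PhantomRMYoshida dropped the item `StableYoshidaCongruenceModFaltings` (stmt-15108) at rev 14
(2026-08-16T15:00Z). The declaration `Summit.Langlands.Langlands.Theses.PhantomRMYoshida.StableYoshidaCongruenceModFaltings`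
therefore no longer exists in the route file and this accepted module stopped elaborating (stale olean; buildfix lane
2026-08-19). Re-created here under its original name so the result keeps building; the statement of every previously
accepted declaration in this file is unchanged. -/
def StableYoshidaCongruenceModFaltings : Prop :=
  FaltingsFinitenessI → StableYoshidaCongruence

end Summit.Langlands.Langlands.Theses.PhantomRMYoshida

namespace Summit.Langlands.Langlands.Theorems.PhantomRMYoshida

open CategoryTheory
open Literature.AlgebraicGeometry.Motives Literature.AlgebraicGeometry.Motives.AbelianVariety
open Literature.NumberTheory.GaloisRepresentations
open Summit.Langlands.Langlands.Theses.PhantomRMYoshida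

/-! ## The crux implies its conditional form -/

/-- **Crux 3 ⟹ item stmt-Langlands-15108.**  `StableYoshidaCongruence → StableYoshidaCongruenceModFaltings`
(the latter is `FaltingsFinitenessI → StableYoshidaCongruence`): discard the Faltings hypothesis.
Pure logic; this is the one-line closer of the item from the crux announced in the route file. -/
theorem stableYoshidaCongruenceModFaltings_of_stableYoshidaCongruence (h : StableYoshidaCongruence) :
    StableYoshidaCongruenceModFaltings :=
  fun _ => h

/-! ## Stub 3i of the picked line becomes unconditional under the gate -/

/-- **Irreducibility of `H¹_ét(B_ℚ̄, ℚ̄_p)` for `End_ℚ(B) = ℤ`, from Finiteness I alone.**  Under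
`FaltingsFinitenessI`: for an abelian variety `B/ℚ` with `End_ℚ(B) = ℤ · id`, a `ℚ_p`-basis `b` of
`V_p B` indexed by `Fin 4`, and `ρ₀ : Γ_ℚ → GL₄(ℚ̄_p)` the framed contragredient of `V_p B ⊗ ℚ̄_p` in
the dual basis (`ρ₀ g = ([g⁻¹]_b ⊗ ℚ̄_p)ᵀ`), `ρ₀` is irreducible.  This is Stub 3i of the crux line
`level-three-weierstrass-switch` (`stub_tateModuleIrreducible_of`, landed conditional on Faltings'
Satz 3–4 for `(B, p)`) with its two Faltings hypotheses discharged from the gate by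
`faltings_tate_bijective_of_finitenessI` and `isSemisimpleRepresentation_rationalTateRep_of_finitenessI`.
[cite: Faltings1983Endlichkeit, §5 Satz 3–4] -/
theorem tateModuleIrreducible_of_faltingsFinitenessI (hFin : FaltingsFinitenessI)
    (p : ℕ) [Fact p.Prime] (B : AbelianVariety ℚ)
    (b : Module.Basis (Fin 4) ℚ_[p] (B.rationalTateModule p))
    (ρ₀ : FramedGaloisRep ℚ (PadicAlgCl p) 4)
    (hfr : ∀ g : Field.absoluteGaloisGroup ℚ,
      (ρ₀ g).val =
        ((LinearMap.toMatrix b b (B.rationalTateRep p g⁻¹)).map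
          (algebraMap ℚ_[p] (PadicAlgCl p))).transpose)
    (hEnd : ∀ f : B ⟶ B, ∃ n : ℤ, f = n • 𝟙 B) :
    ρ₀.toGaloisRep.IsIrreducible :=
  Summit.Langlands.Langlands.Cruxes.StableYoshidaCongruence.LevelThreeWeierstrassSwitch.stub_tateModuleIrreducible_of
    p B (faltings_tate_bijective_of_finitenessI hFin p B)
    (isSemisimpleRepresentation_rationalTateRep_of_finitenessI hFin p B) b ρ₀ hfr hEnd

/-! ## Direct-closer shapes: a Faltings-conditional proof of the crux yields the item -/

/-- **Direct closer, fact-stub form.**  If the crux `StableYoshidaCongruence` is proved taking the two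
Faltings fact stubs of the line `level-three-weierstrass-switch` as hypotheses — `∀ p B,
faltings_tate_bijective B B p` and `∀ p B, isSemisimpleRepresentation_rationalTateRep B p`, exactly the
signatures of `stub_fact_faltingsTateBijective` / `stub_fact_faltingsSemisimple` — then the item
`StableYoshidaCongruenceModFaltings` holds: `intro hFin` and discharge both from Finiteness I
(`faltings_tate_bijective_of_finitenessI`, `isSemisimpleRepresentation_rationalTateRep_of_finitenessI`).
[cite: Faltings1983Endlichkeit, §5 Satz 3–4] -/
theorem stableYoshidaCongruenceModFaltings_of_imp_faltings_facts
    (h : (∀ (p : ℕ) [Fact p.Prime] (B : AbelianVariety ℚ), faltings_tate_bijective B B p) →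
      (∀ (p : ℕ) [Fact p.Prime] (B : AbelianVariety ℚ),
          isSemisimpleRepresentation_rationalTateRep B p) →
        StableYoshidaCongruence) :
    StableYoshidaCongruenceModFaltings :=
  fun hFin =>
    h (fun p _ B => faltings_tate_bijective_of_finitenessI hFin p B)
      (fun p _ B => isSemisimpleRepresentation_rationalTateRep_of_finitenessI hFin p B)

/-- **Direct closer, gate form.**  A proof of the crux from the route's second Faltings gate
`FaltingsTateModuleQ` (item stmt-Langlands-15085) yields the item, through
`faltingsTateModuleQ_of_finitenessI : FaltingsFinitenessI → FaltingsTateModuleQ`.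
[cite: Faltings1983Endlichkeit, §5 Satz 3–4] -/
theorem stableYoshidaCongruenceModFaltings_of_imp_faltingsTateModuleQ
    (h : FaltingsTateModuleQ → StableYoshidaCongruence) : StableYoshidaCongruenceModFaltings :=
  fun hFin => h (faltingsTateModuleQ_of_finitenessI hFin)

/-- **Direct closer, Tate-module form** ("Finiteness I only removes the in-sector irreducibility
input"): if the crux follows from the conclusion of Stub 3i of the line
`level-three-weierstrass-switch` for all data — irreducibility of the framed contragredient `H¹` of
every abelian variety `B/ℚ` with `End_ℚ(B) = ℤ · id` and a four-element `ℚ_p`-basis of `V_p B`,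
i.e. the registered signature of `stub_tateModuleIrreducible` with its two Faltings hypotheses
removed — then the item holds, by `tateModuleIrreducible_of_faltingsFinitenessI`.
[cite: Faltings1983Endlichkeit, §5 Satz 3–4] -/
theorem stableYoshidaCongruenceModFaltings_of_imp_tateModuleIrreducible
    (h : (∀ (p : ℕ) [Fact p.Prime] (B : AbelianVariety ℚ)
        (b : Module.Basis (Fin 4) ℚ_[p] (B.rationalTateModule p))
        (ρ₀ : FramedGaloisRep ℚ (PadicAlgCl p) 4),
        (∀ g : Field.absoluteGaloisGroup ℚ,
          (ρ₀ g).val =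
            ((LinearMap.toMatrix b b (B.rationalTateRep p g⁻¹)).map
              (algebraMap ℚ_[p] (PadicAlgCl p))).transpose) →
        (∀ f : B ⟶ B, ∃ n : ℤ, f = n • 𝟙 B) →
        ρ₀.toGaloisRep.IsIrreducible) → StableYoshidaCongruence) :
    StableYoshidaCongruenceModFaltings :=
  fun hFin => h (fun p _ B b ρ₀ hfr hEnd => tateModuleIrreducible_of_faltingsFinitenessI hFin p B b ρ₀ hfr hEnd)

end Summit.Langlands.Langlands.Theorems.PhantomRMYoshida
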